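import Mathlib.Analysis.Real.Pi.Bounds
import HarnessLib
import Summits.RiemannHypothesis.RiemannHypothesis.Theses.WeilWindowFlow
import Literature.NumberTheory.LFunctions.WeilArchimedeanPositivityHolds
import Literature.NumberTheory.LFunctions.WeilGroundState
import Literature.NumberTheory.LFunctions.SchoenfeldPiLargeBounds

/-!
# Route WeilWindowFlow, item `StrictArchimedeanBottom`: `0 < ε((log 2)/2)`

Item stmt-RiemannHypothesis-1042 (support) of route `WeilWindowFlow`: strict positivity of the
bottom `ε(a) = weilGroundEnergy a` of Weil's quadratic form at the dyadic (archimedean) window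
`a = (log 2)/2`.

## Proof

The tree proves `0 ≤ E(g)` on `C((log 2)/2)` (Yoshida's analytic form `E = weilArchQuadratic`,
`E(g) = Re Q(g)` there since no prime enters) by the kernel-checked certificate
`weilCert` (`WeilPositivityCertificate*.lean`, soundness theorem
`WeilCert.weilArchQuadratic_nonneg_of_check`). That soundness proof bounds the term
`-(log π) ‖g‖₂²` of `E(g)` using the rational constant `logPiHi = 1.1447299 ≥ log π`; every other
step is an inequality between the remaining quantities. Since in fact
`log π = 1.14472988584… < 1.1447299` STRICTLY (`log_pi_lt_logPiHi`, from Mathlib's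
`Real.pi_lt_d20`, `Real.log_two_gt_d9` and the series of `log (1 - x)`), replaying the soundness
proof with the exact `log π` kept aside gives the MARGIN version
`(logPiHi - log π) ‖g‖₂² ≤ E(g)` (`WeilCert.weilArchQuadratic_margin_of_check`), i.e.
`E(g) ≥ δ ‖g‖₂²` with `δ = logPiHi - log π > 0` (`δ ≈ 1.4 · 10⁻⁸`). Hence every element of the
set whose infimum is `ε((log 2)/2)` is `≥ δ`; the set is nonempty (`exists_isWeilTest_sphere`),
so `ε((log 2)/2) ≥ δ > 0` (`le_csInf`).

(The numerical value of the bottom is `≈ 10⁻³`, Connes–Consani arXiv:2106.01715 §2; the margin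
extracted here is the cheapest kernel-certified one, not the sharp one.)

## References

* H. Yoshida, *On Hermitian forms attached to zeta functions*, Adv. Stud. Pure Math. 21 (1992),
  Thm 1 (p. 310) — equality iff `φ = 0` on `K((log 2)/2)`.
* The tree's certificate: `Literature/NumberTheory/LFunctions/WeilPositivityCertificate.lean`.
-/

-- `Summit.RiemannHypothesis.RiemannHypothesis.Theorems` is the prescribed namespace (D-0017:
-- single-conjunct summit, Sub = Summit), so the duplicated component is intended.
set_option linter.dupNamespace false

noncomputable section

open Complex Finset MeasureTheory Set Filter
open scoped Real Topology ComplexConjugate BigOperators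

namespace Summit.RiemannHypothesis.RiemannHypothesis.Theorems

open Literature.NumberTheory.LFunctions Literature.NumberTheory.LFunctions.WeilCert

/-! ## The strict bound `log π < logPiHi` -/

/-- `log π < logPiHi = 1.1447299` (`log π = 1.14472988584…`; the tree's kernel enclosure
`SchoenfeldBound.log_pi_lt_d8`, from `Real.pi_lt_d20`). [folklore] -/
theorem log_pi_lt_logPiHi : Real.log π < ((logPiHi : ℚ) : ℝ) := by
  have e : ((logPiHi : ℚ) : ℝ) = 1.1447299 := by unfold logPiHi; push_cast; norm_num
  rw [e]
  exact SchoenfeldBound.log_pi_lt_d8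

/-! ## The certificate with the `log π` margin -/

section Margin

/-- **Soundness of the certificate, with the `log π` margin.** If `c.check = true` then for every
test function `g` with `tsupport g ⊆ [-(log 2)/2, (log 2)/2]`,
`(logPiHi − log π) ‖g‖₂² ≤ E(g)`. This is the proof of
`WeilCert.weilArchQuadratic_nonneg_of_check` verbatim, except that the step
`(log π) ‖g‖₂² ≤ logPiHi ‖g‖₂²` is not spent: the checker certifies the chain with the constant
`logPiHi`, so the difference `(logPiHi − log π)‖g‖₂²` survives as a margin. [folklore] -/
theorem weilArchQuadratic_margin_of_check {c : WeilCert} (h : c.check = true) {g : ℝ → ℂ}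
    (hg : IsWeilTest g)
    (hsupp : tsupport g ⊆ Icc (-(Real.log 2 / 2)) (Real.log 2 / 2)) :
    (((logPiHi : ℚ) : ℝ) - Real.log π) * weilNorm2Sq g ≤ weilArchQuadratic g := by
  obtain ⟨hcells, hsc, hb0, hb1⟩ := check_spec h
  obtain ⟨h2a, ha1q, hT, haT, hρT, hN, hκ⟩ := scalars_spec hsc
  set a : ℝ := (c.a0 : ℝ) with ha_def
  have hlog : Real.log 2 / 2 ≤ a := log_two_half_le_of_check h2a
  have ha : 0 < a := lt_of_lt_of_le (by have := Real.log_pos one_lt_two; positivity) hlog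
  have ha1 : a ≤ 1 := by rw [ha_def]; exact_mod_cast ha1q
  have hsupp' : tsupport g ⊆ Icc (-a) a := hsupp.trans (Icc_subset_Icc (by linarith) hlog)
  set n := c.N + 1 with hn
  set nu := c.nuTab with hnu
  set M : ℕ → ℂ := weilMoment a g with hM
  set L := weilNorm1 g with hL
  set N2 := weilNorm2Sq g with hN2
  set z : ℕ → ℕ → ℝ := fun k l ↦ (conj (M k) * M l).re with hz
  have hzsym : ∀ k l, z k l = z l k := fun k l ↦ by
    rw [hz]; simp only; rw [← WeilAna.re_mul_conj_eq, mul_comm]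
  have hL0 : 0 ≤ L := weilNorm1_nonneg g
  have hN20 : 0 ≤ N2 := weilNorm2Sq_nonneg g
  have hL1 : L ^ 2 ≤ 2 * a * N2 := weilNorm1_sq_le hg ha hsupp'
  -- the three terms of E(g)
  set P : ℝ := 2 * (weilMellin g 0 * conj (weilMellin g 1)).re with hP
  set A : ℝ := ∫ t : ℝ, ‖weilMellin g (1 / 2 + t * I)‖ ^ 2 *
    Literature.Analysis.SpecialFunctions.reDigammaQuarter t with hA
  set Γ : ℝ := ∫ t : ℝ, ‖weilMellin g (1 / 2 + t * I)‖ ^ 2 * cellsGamma c.wL c.cells t with hΓ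
  have hE : weilArchQuadratic g = P - Real.log π * N2 + 1 / (2 * π) * A := by
    rw [weilArchQuadratic_eq]; rfl
  -- Step A
  set ρ : ℝ := 2 * (a / 2) ^ (c.N + 1) / (c.N + 1).factorial with hρ
  have hρ0 : 0 ≤ ρ := by positivity
  have hPA : ∑ k ∈ range n, ∑ l ∈ range n,
      (2 * ((-a / 2) ^ k / k.factorial) * ((a / 2) ^ l / l.factorial)) * z k l -
      (8 * ρ + 6 * ρ ^ 2) * L ^ 2 ≤ P := WeilAna.polar_lower_bound hg ha ha1 hsupp' c.N
  rw [polar_symmetrize n a z hzsym] at hPA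
  -- Step B
  have hB : (c.wL : ℝ) * (2 * π * N2) - Γ ≤ A := arch_lower_bound hcells hg
  -- Step C
  have hC : Γ ≤ ∑ k ∈ range n, ∑ l ∈ range n, gHat c k l * z k l +
      5 * L ^ 2 * (c.nuPrime nu : ℝ) := by
    have := freq_integral_bound hcells hsc hg (by rwa [← ha_def])
    rw [← ha_def] at this
    exact this
  have hΓ0 : 0 ≤ Γ :=
    integral_nonneg fun t ↦ mul_nonneg (sq_nonneg _) (cellsGamma_nonneg hcells t)
  -- constants
  set q : ℝ := ((invTwoPiHi : ℚ) : ℝ) with hq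
  have hq1 : 1 / (2 * π) ≤ q := invTwoPiHi_ge
  have hq0 : 0 ≤ q := invTwoPiHi_nonneg
  have hν0 : 0 ≤ ((c.nuPrime nu : ℚ) : ℝ) := by
    unfold nuPrime
    rw [hnu, getV_nuTab (by omega)]
    push_cast
    have ha0q : (0 : ℚ) ≤ c.a0 := by
      have := ha.le; rw [ha_def] at this; exact_mod_cast this
    have := nuQ_nonneg hcells ha0q (q := c.N + 1) ⟨c.nb, by omega⟩
    positivity
  have hpi : 0 < 1 / (2 * π) := by positivity
  -- combine A, B, C (the `log π` term is kept exact)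
  have hB' : (c.wL : ℝ) * N2 - 1 / (2 * π) * Γ ≤ 1 / (2 * π) * A := by
    calc (c.wL : ℝ) * N2 - 1 / (2 * π) * Γ = 1 / (2 * π) * ((c.wL : ℝ) * (2 * π * N2) - Γ) := by
          field_simp
      _ ≤ 1 / (2 * π) * A := mul_le_mul_of_nonneg_left hB hpi.le
  have h3 : 1 / (2 * π) * Γ ≤ q * Γ := mul_le_mul_of_nonneg_right hq1 hΓ0
  have h4 : q * Γ ≤ q * (∑ k ∈ range n, ∑ l ∈ range n, gHat c k l * z k l +
      5 * L ^ 2 * (c.nuPrime nu : ℝ)) := mul_le_mul_of_nonneg_left hC hq0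
  have step1 : ∑ k ∈ range n, ∑ l ∈ range n,
      ((if k % 2 = l % 2 then
        (-1 : ℝ) ^ k * 2 * ((a / 2) ^ k / k.factorial) * ((a / 2) ^ l / l.factorial) else 0) -
        q * gHat c k l) * z k l +
      ((c.wL : ℝ) - (logPiHi : ℚ)) * N2 -
      ((8 * ρ + 6 * ρ ^ 2) + 5 * q * (c.nuPrime nu : ℝ)) * L ^ 2 ≤
      weilArchQuadratic g - (((logPiHi : ℚ) : ℝ) - Real.log π) * N2 := by
    rw [hE]
    have e1 : ∑ k ∈ range n, ∑ l ∈ range n,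
        ((if k % 2 = l % 2 then
          (-1 : ℝ) ^ k * 2 * ((a / 2) ^ k / k.factorial) * ((a / 2) ^ l / l.factorial) else 0) -
          q * gHat c k l) * z k l =
        ∑ k ∈ range n, ∑ l ∈ range n,
          (if k % 2 = l % 2 then
            (-1 : ℝ) ^ k * 2 * ((a / 2) ^ k / k.factorial) * ((a / 2) ^ l / l.factorial) else 0) *
              z k l -
        q * ∑ k ∈ range n, ∑ l ∈ range n, gHat c k l * z k l := by
      rw [Finset.mul_sum, ← Finset.sum_sub_distrib]
      refine Finset.sum_congr rfl fun k _ ↦ ?_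
      rw [Finset.mul_sum, ← Finset.sum_sub_distrib]
      refine Finset.sum_congr rfl fun l _ ↦ ?_
      ring
    rw [e1]
    linarith [hPA, hB', h3, h4]
  -- rewrite the matrix as `pmQ`
  have step2 : ∑ k ∈ range n, ∑ l ∈ range n,
      ((if k % 2 = l % 2 then
        (-1 : ℝ) ^ k * 2 * ((a / 2) ^ k / k.factorial) * ((a / 2) ^ l / l.factorial) else 0) -
        q * gHat c k l) * z k l =
      ∑ k ∈ range n, ∑ l ∈ range n, ((c.pmQ nu k l : ℚ) : ℝ) * z k l := by
    refine Finset.sum_congr rfl fun k hk ↦ Finset.sum_congr rfl fun l hl ↦ ?_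
    rw [pmQ_cast (Finset.mem_range.1 hk) (Finset.mem_range.1 hl)]
  rw [step2] at step1
  -- rounding
  have hMk : ∀ k, ‖M k‖ ≤ L := fun k ↦ norm_weilMoment_le hg ha hsupp' k
  have hround : ∑ k ∈ range n, ∑ l ∈ range n, ((c.prQ nu k l : ℚ) : ℝ) * z k l -
      ∑ k ∈ range n, ∑ l ∈ range n, ((c.pmQ nu k l : ℚ) : ℝ) * z k l ≤
      1 / 2 ^ c.pg * (n : ℝ) ^ 2 * L ^ 2 :=
    WeilAlg.quad_rounding_le n (fun k l ↦ ((c.prQ nu k l : ℚ) : ℝ))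
      (fun k l ↦ ((c.pmQ nu k l : ℚ) : ℝ)) (1 / 2 ^ c.pg) L (fun k l ↦ by
        rw [abs_sub_comm]
        unfold prQ
        exact abs_cast_sub_ratRd_le c.pg (c.pmQ nu k l)) M hMk
  -- κ_exact
  have hcoef : 0 ≤ (8 * ρ + 6 * ρ ^ 2) + 5 * q * (c.nuPrime nu : ℝ) +
      1 / 2 ^ c.pg * (n : ℝ) ^ 2 := by
    positivity
  have hkex : ((c.kappaExact nu : ℚ) : ℝ) =
      ((c.wL : ℝ) - (logPiHi : ℚ)) -
        2 * a * ((8 * ρ + 6 * ρ ^ 2) + 5 * q * (c.nuPrime nu : ℝ) +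
          1 / 2 ^ c.pg * (n : ℝ) ^ 2) := by
    unfold kappaExact etaP rhoE
    push_cast
    rw [hρ, hq, hn, ha_def]
    push_cast
    ring
  have hκle : ((c.kappaQ nu : ℚ) : ℝ) ≤ ((c.kappaExact nu : ℚ) : ℝ) := by
    unfold kappaQ; exact_mod_cast ratRd_le c.pg _
  have hκ0 : (0 : ℝ) ≤ ((c.kappaQ nu : ℚ) : ℝ) := by exact_mod_cast hκ
  -- E - margin ≥ Σ pr z + κ N2
  have step3 : ∑ k ∈ range n, ∑ l ∈ range n, ((c.prQ nu k l : ℚ) : ℝ) * z k l +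
      ((c.kappaQ nu : ℚ) : ℝ) * N2 ≤
      weilArchQuadratic g - (((logPiHi : ℚ) : ℝ) - Real.log π) * N2 := by
    have h1 : ((c.kappaQ nu : ℚ) : ℝ) * N2 ≤ ((c.kappaExact nu : ℚ) : ℝ) * N2 :=
      mul_le_mul_of_nonneg_right hκle hN20
    rw [hkex] at h1
    have h2 := mul_le_mul_of_nonneg_left hL1 hcoef
    linarith [step1, hround, h1, h2]
  -- Bessel and the algebraic core
  have hbes : 2 * (∑ k ∈ range n, conj (c.uVec M k) * M k).re -
      (∑ k ∈ range n, ∑ l ∈ range n,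
        conj (c.uVec M k) * c.uVec M l * (gramH a k l : ℂ)).re ≤ N2 :=
    weilNorm2Sq_ge_bessel hg ha hsupp' n (c.uVec M)
  have hcore : 0 ≤ (∑ k ∈ range n, ∑ l ∈ range n, ((c.prQ nu k l : ℚ) : ℝ) * z k l) +
      ((c.kappaQ nu : ℚ) : ℝ) *
        (2 * (∑ k ∈ range n, conj (c.uVec M k) * M k).re -
          (∑ k ∈ range n, ∑ l ∈ range n,
            conj (c.uVec M k) * c.uVec M l * (gramH a k l : ℂ)).re) := by
    have := core_nonneg (c := c) (nu := nu) hN hb0 hb1 a ha_def.symm M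
    rw [← hn] at this
    exact this
  have h4 := mul_le_mul_of_nonneg_left hbes hκ0
  linarith [step3, h4, hcore]

end Margin

/-- **Margin form of Yoshida's Theorem 1 on `C((log 2)/2)`**: for every test function `g` with
`tsupport g ⊆ [-(log 2)/2, (log 2)/2]`, `(logPiHi − log π) ∫ |g|² ≤ Re Q(g)`, with
`logPiHi − log π > 0`. (Yoshida 1992, Thm 1 p. 310 states `⟨φ, φ⟩ ≥ 0` with equality iff `φ = 0`;
the quantitative margin here is the one the tree's kernel certificate `weilCert` happens to
carry.) [folklore] -/
theorem weilQuadratic_re_ge_margin {g : ℝ → ℂ} (hg : IsWeilTest g)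
    (hsupp : tsupport g ⊆ Icc (-(Real.log 2 / 2)) (Real.log 2 / 2)) :
    (((logPiHi : ℚ) : ℝ) - Real.log π) * ∫ t : ℝ, ‖g t‖ ^ 2 ≤ (weilQuadratic g).re := by
  rw [weilQuadratic_re_eq_weilArchQuadratic hg hsupp]
  exact weilArchQuadratic_margin_of_check weilCert_check hg hsupp

/-! ## The item -/

/-- **Item `StrictArchimedeanBottom` (stmt-RiemannHypothesis-1042) of route WeilWindowFlow:**
`0 < ε((log 2)/2)`, the bottom of Weil's quadratic form on the dyadic window is strictly
positive. Proof: every value `Re Q(g)` on the unit `L²`-sphere of test functions supported in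
`[-(log 2)/2, (log 2)/2]` is `≥ δ := logPiHi − log π > 0` (`weilQuadratic_re_ge_margin`,
`log_pi_lt_logPiHi`), the sphere is nonempty (`exists_isWeilTest_sphere`), hence
`ε((log 2)/2) = sInf {…} ≥ δ > 0`. -/
theorem strictArchimedeanBottom_proof :
    Summit.RiemannHypothesis.RiemannHypothesis.Theses.WeilWindowFlow.StrictArchimedeanBottom := by
  unfold Summit.RiemannHypothesis.RiemannHypothesis.Theses.WeilWindowFlow.StrictArchimedeanBottom
    weilGroundEnergy
  have hδ : 0 < ((logPiHi : ℚ) : ℝ) - Real.log π := sub_pos.2 log_pi_lt_logPiHi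
  have ha : 0 < Real.log 2 / 2 := by
    have := Real.log_pos one_lt_two
    positivity
  obtain ⟨g₀, hg₀, hsupp₀, hnorm₀⟩ := exists_isWeilTest_sphere ha
  refine lt_of_lt_of_le hδ (le_csInf ⟨_, g₀, hg₀, hsupp₀, hnorm₀, rfl⟩ ?_)
  rintro x ⟨g, hg, hsupp, hnorm, rfl⟩
  have h := weilQuadratic_re_ge_margin hg hsupp
  rwa [hnorm, mul_one] at h

end Summit.RiemannHypothesis.RiemannHypothesis.Theorems

end
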